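/-
Copyright: statement-level skeleton of a published paper (lit-balaban cell, Phase-2 proof seat p13, gen 6). No proof
claims beyond what the kernel checks below.
-/
import Literature.MathematicalPhysics.QuantumFieldTheory.BalabanImbrieJaffe1984to88.BIJ88SDerivative305

/-!
# `BalabanImbrieJaffe1984to88.BIJ88TruncatedPair306` — T. Bałaban, J. Imbrie, A. Jaffe, *Effective action and cluster
properties of the abelian Higgs model*, Commun. Math. Phys. **114** (1988) 257–315 [BalabanImbrieJaffe1988], §5.13
p. 305–306 [PDF 49–50]: **"Each Φ contracts through a C_s to another Φ, to an f(□_i) or to ℱ. If a closed loop forms,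
or if a train of covariances beginning and ending in ℱ forms, then the term disappears with truncation. Thus we have
only trains beginning with a δ/δΦ and ending in either δ/δΦ or ℱ."** — PROVED AT SECOND ORDER, the order of the
quadratic term `Σ_{j≠i}s_j⟨□_iΦ,Δ□_jΦ⟩` pulled down by the first `s`-derivative (`…BIJ88SDerivative305`): the complete
contraction of a pair of fields `Φ(w)Φ(w′)` against a `C²_b` factor `H` in the Gaussian integral with linear term, the
"vacuum" pair (closed loop + ℱ–ℱ train), and their difference — the truncated pair — in which exactly the closed loop
and the ℱ–ℱ train have disappeared.

statement-level skeleton of published theorems with citation tags; proofs where landed; nothing here is a claim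
about the Yang–Mills mass gap

PDF held: `paper:balaban1988-cmp114-bij-abelian-higgs-effective-action` (journal page = PDF page + 256; p. 305–306
read with `lit read … --pages 49-50`).

CITATION HEADER (lean-in-tree rule).  lit-balaban cell (HOME `run/shared/lean/pub/lit-balaban/`), Phase 2, seat p13
gen 6 (unit `lit-balaban-p13-g6`); sixth file of the p. 305–306 group (`…BIJ88CsDecay305` p254974, `…BIJ88CsClusters306`
p255115, `…BIJ88ClusterFactorization306` p255752, `…BIJ88IntegrationByParts305` p256140, `…BIJ88SDerivative305` p256629);
row **C2.Eq5.13.3-5.13.4** of `HOME/lit-balaban-r16/ROWS-C2-part2.md` (owner r16, referee ref-5), the p. 305–306 member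
quoted above.  USED BY NAME, nothing restated: `…BIJ88IntegrationByParts305` (`ibp_source`, `ibp_fields`: Glimm–Jaffe
(9.1.28)/(9.1.32) with the linear term, via `…Balaban1983to89.B14Eq328GaussianIBP`), `…BIJ88SDerivative305`
(`integral_weight_mul_source_pos`: the partition function is positive), the weight/linear term `weight`/`source` of
`…Balaban1983to89.B2Eq228Conditioning`; Mathlib (`fderiv_clm_apply`, `ContinuousLinearMap.opNorm_flip`).

## What is proved (0 `sorry`, standard axioms, theorems only, no new `def`)

Fields `Φ : S → ℝ`, precision `A` positive definite (`= −Δ_s`), `C := A⁻¹` (`= C_s`), weight `dμ = e^{−½⟨Φ,AΦ⟩}e^{⟨ℱ,Φ⟩}dΦ`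
(`weight A Φ * source ℱ Φ`), `Z = ∫dμ`; `H ∈ C²` with `H, DH, D²H` bounded (the product of the `f(□_i)` and smooth
cutoffs); `∂_u H := DH(·)u`, `∂_{u′}∂_u H := D(∂_uH)(·)u′`.
* §1 `contDiff_one_fderiv_apply`, `norm_fderiv_apply_le`, `norm_fderiv_fderiv_apply_le`: `∂_{Cw}H ∈ C¹_b` for `H ∈ C²_b`
  (so that a second field can be integrated by parts against it).
* §2 `ibp_one_field` (*"Each Φ contracts through a C_s to another Φ, to an f(□_i) or to ℱ"*, one field against one):
  `∫Φ(w)Φ(w′)H dμ = ⟨Cw,w′⟩∫H dμ + ∫Φ(w′)∂_{Cw}H dμ + ⟨Cw,ℱ⟩∫Φ(w′)H dμ`; **`pair_contraction`** (both fields integrated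
  by parts): `∫Φ(w)Φ(w′)H dμ = [⟨Cw,w′⟩ + ⟨Cw,ℱ⟩⟨Cw′,ℱ⟩]∫H dμ + ⟨Cw′,ℱ⟩∫∂_{Cw}H dμ + ⟨Cw,ℱ⟩∫∂_{Cw′}H dμ + ∫∂_{Cw′}∂_{Cw}H dμ`
  — the four printed possibilities: closed loop `⟨Cw,w′⟩`, ℱ–ℱ train `⟨Cw,ℱ⟩⟨Cw′,ℱ⟩`, δ/δΦ–ℱ trains, δ/δΦ–δ/δΦ train.
* §3 `pair_vacuum` (`H = 1`): `∫Φ(w)Φ(w′)dμ = [⟨Cw,w′⟩ + ⟨Cw,ℱ⟩⟨Cw′,ℱ⟩]·Z` — *"a closed loop … or … a train of covariances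
  beginning and ending in ℱ"*.
* §4 **`pair_truncated`** — *"then the term disappears with truncation. Thus we have only trains beginning with a δ/δΦ
  and ending in either δ/δΦ or ℱ"*: `Z·∫Φ(w)Φ(w′)H dμ − (∫Φ(w)Φ(w′)dμ)(∫H dμ) = Z·[⟨Cw′,ℱ⟩∫∂_{Cw}H dμ + ⟨Cw,ℱ⟩∫∂_{Cw′}H dμ
  + ∫∂_{Cw′}∂_{Cw}H dμ]`; normalized, **`pair_truncated_expectation`**:
  `⟨Φ(w)Φ(w′)H⟩ − ⟨Φ(w)Φ(w′)⟩⟨H⟩ = ⟨Cw′,ℱ⟩⟨∂_{Cw}H⟩ + ⟨Cw,ℱ⟩⟨∂_{Cw′}H⟩ + ⟨∂_{Cw′}∂_{Cw}H⟩` (`⟨X⟩ := ∫X dμ / Z`).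
READING (declared).  In (5.13.3) the surviving trains for ONE pair `{i₁,i₂}` are printed as
`⟨δ/δΦ, C_s□_{i₁}Δ□_{i₂}C_s(½δ/δΦ + ℱ)⟩`; summing `pair_truncated_expectation` over the coordinate pairs `(x,y)` with
weights `M_{xy}` (`M = □_{i₁}Δ□_{i₂} + □_{i₂}Δ□_{i₁}`) gives `Σ_{x,y}M_{xy}[⟨Ce_y,ℱ⟩⟨∂_{Ce_x}H⟩ + ⟨Ce_x,ℱ⟩⟨∂_{Ce_y}H⟩ +
⟨∂_{Ce_y}∂_{Ce_x}H⟩]`, i.e. both orientations of each train — *"The 1/2 for the δ²/δΦ² term compensates for the fact that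
we count a walk as being different from its reverse"*; that resummation and (5.13.3) itself are NOT modelled here.
HONEST SCOPE.  Finite-dimensional real Gaussian integrals; second order only (one pair of fields); `H ∈ C²_b`
(characteristic functions as smooth cutoffs).  NOT summit progress; NOT continuum; NOT Clay.  Imports
`BIJ88SDerivative305`; modifies nothing.
-/

namespace Literature.MathematicalPhysics.QuantumFieldTheory.BalabanImbrieJaffe1984to88.BIJ88TruncatedPair306

open MeasureTheory Matrix Finset Filter
open scoped BigOperators
open Literature.MathematicalPhysics.QuantumFieldTheory.Balaban1983to89
open B2Eq228Conditioning (weight source)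
open BIJ88IntegrationByParts305 (ibp_source ibp_fields)
open BIJ88SDerivative305 (integral_weight_mul_source_pos)

variable {S : Type} [Fintype S]

/-! ## §1  `∂_{Cw}H` is again a bounded `C¹` observable when `H ∈ C²_b` -/

/-- For `H ∈ C²`, the directional derivative `Φ ↦ DH(Φ)u` is `C¹` — a second field can be integrated by parts
against it (*"We integrate by parts all fields appearing in this formula"*). [cite: BalabanImbrieJaffe1988, §5.13 p.305] -/
theorem contDiff_one_fderiv_apply {H : (S → ℝ) → ℝ} (hH : ContDiff ℝ 2 H) (u : S → ℝ) :
    ContDiff ℝ 1 (fun φ : S → ℝ => fderiv ℝ H φ u) :=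
  (hH.fderiv_right (by norm_num)).clm_apply contDiff_const

/-- `|DH(Φ)u| ≤ ‖DH(Φ)‖‖u‖ ≤ K₁‖u‖`. [folklore] [cite: BalabanImbrieJaffe1988, §5.13 p.305] -/
theorem norm_fderiv_apply_le {H : (S → ℝ) → ℝ} {K₁ : ℝ} (h1 : ∀ φ, ‖fderiv ℝ H φ‖ ≤ K₁) (u : S → ℝ)
    (φ : S → ℝ) : ‖fderiv ℝ H φ u‖ ≤ K₁ * ‖u‖ :=
  ((fderiv ℝ H φ).le_opNorm u).trans (mul_le_mul_of_nonneg_right (h1 φ) (norm_nonneg _))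

/-- The derivative of `Φ ↦ DH(Φ)u` is `z ↦ D²H(Φ)z u`, of norm `≤ ‖D²H(Φ)‖‖u‖ ≤ K₂‖u‖`.
[folklore] [cite: BalabanImbrieJaffe1988, §5.13 p.305] -/
theorem norm_fderiv_fderiv_apply_le {H : (S → ℝ) → ℝ} (hH : ContDiff ℝ 2 H) {K₂ : ℝ}
    (h2 : ∀ φ, ‖fderiv ℝ (fderiv ℝ H) φ‖ ≤ K₂) (u : S → ℝ) (φ : S → ℝ) :
    ‖fderiv ℝ (fun ψ : S → ℝ => fderiv ℝ H ψ u) φ‖ ≤ K₂ * ‖u‖ := by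
  have h1 : ContDiff ℝ 1 (fderiv ℝ H) := hH.fderiv_right (by norm_num)
  rw [fderiv_clm_apply (h1.differentiable one_ne_zero φ) (differentiableAt_const u), fderiv_const_apply,
    ContinuousLinearMap.comp_zero, zero_add]
  calc ‖(fderiv ℝ (fderiv ℝ H) φ).flip u‖ ≤ ‖(fderiv ℝ (fderiv ℝ H) φ).flip‖ * ‖u‖ :=
        ContinuousLinearMap.le_opNorm _ _
    _ = ‖fderiv ℝ (fderiv ℝ H) φ‖ * ‖u‖ := by rw [ContinuousLinearMap.opNorm_flip]
    _ ≤ K₂ * ‖u‖ := mul_le_mul_of_nonneg_right (h2 φ) (norm_nonneg _)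

variable [DecidableEq S]

/-! ## §2  The complete contraction of a pair of fields -/

/-- **"Each Φ contracts through a C_s to another Φ, to an f(□_i) or to ℱ"** — one field against one field and a `C¹_b`
factor: `∫Φ(w)Φ(w′)H dμ = ⟨Cw,w′⟩∫H dμ + ∫Φ(w′)∂_{Cw}H dμ + ⟨Cw,ℱ⟩∫Φ(w′)H dμ` (`C = A⁻¹`, `dμ = e^{−½⟨Φ,AΦ⟩}e^{⟨ℱ,Φ⟩}dΦ`;
the singleton case of `BIJ88IntegrationByParts305.ibp_fields`). [cite: BalabanImbrieJaffe1988, §5.13 p.305] -/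
theorem ibp_one_field (A : Matrix S S ℝ) (hA : A.PosDef) (f : S → ℝ) {H : (S → ℝ) → ℝ} (hH : ContDiff ℝ 1 H)
    {K₀ K₁ : ℝ} (h0 : ∀ φ, ‖H φ‖ ≤ K₀) (h1 : ∀ φ, ‖fderiv ℝ H φ‖ ≤ K₁) (w w' : S → ℝ) :
    ∫ φ : S → ℝ, (φ ⬝ᵥ w) * (φ ⬝ᵥ w') * H φ * (weight A φ * source f φ)
      = ((A⁻¹ *ᵥ w) ⬝ᵥ w') * (∫ φ : S → ℝ, H φ * (weight A φ * source f φ))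
        + (∫ φ : S → ℝ, (φ ⬝ᵥ w') * fderiv ℝ H φ (A⁻¹ *ᵥ w) * (weight A φ * source f φ))
        + ((A⁻¹ *ᵥ w) ⬝ᵥ f) * ∫ φ : S → ℝ, (φ ⬝ᵥ w') * H φ * (weight A φ * source f φ) := by
  have h := ibp_fields A hA f ({()} : Finset Unit) (fun _ => w') hH h0 h1 w
  simp only [Finset.sum_singleton, Finset.prod_singleton, Finset.erase_singleton, Finset.prod_empty, one_mul] at h
  have e : ∫ φ : S → ℝ, (φ ⬝ᵥ w) * (φ ⬝ᵥ w') * H φ * (weight A φ * source f φ)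
      = ∫ φ : S → ℝ, (φ ⬝ᵥ w) * ((φ ⬝ᵥ w') * H φ) * (weight A φ * source f φ) := by
    congr 1
    funext φ
    ring
  rw [e, h]

/-- **THE COMPLETE CONTRACTION OF A PAIR** (both fields integrated by parts; `H ∈ C²` with `H, DH, D²H` bounded):
`∫Φ(w)Φ(w′)H dμ = [⟨Cw,w′⟩ + ⟨Cw,ℱ⟩⟨Cw′,ℱ⟩]∫H dμ + ⟨Cw′,ℱ⟩∫∂_{Cw}H dμ + ⟨Cw,ℱ⟩∫∂_{Cw′}H dμ + ∫∂_{Cw′}∂_{Cw}H dμ` — in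
the printed language: the closed loop (`Φ(w)` contracts to `Φ(w′)`), the train beginning and ending in ℱ, the two
trains with one end `δ/δΦ` and one end ℱ, and the train with both ends `δ/δΦ`.
[cite: BalabanImbrieJaffe1988, §5.13 p.305–306] -/
theorem pair_contraction (A : Matrix S S ℝ) (hA : A.PosDef) (f : S → ℝ) {H : (S → ℝ) → ℝ} (hH : ContDiff ℝ 2 H)
    {K₀ K₁ K₂ : ℝ} (h0 : ∀ φ, ‖H φ‖ ≤ K₀) (h1 : ∀ φ, ‖fderiv ℝ H φ‖ ≤ K₁)
    (h2 : ∀ φ, ‖fderiv ℝ (fderiv ℝ H) φ‖ ≤ K₂) (w w' : S → ℝ) :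
    ∫ φ : S → ℝ, (φ ⬝ᵥ w) * (φ ⬝ᵥ w') * H φ * (weight A φ * source f φ)
      = (((A⁻¹ *ᵥ w) ⬝ᵥ w') + ((A⁻¹ *ᵥ w) ⬝ᵥ f) * ((A⁻¹ *ᵥ w') ⬝ᵥ f))
          * (∫ φ : S → ℝ, H φ * (weight A φ * source f φ))
        + ((A⁻¹ *ᵥ w') ⬝ᵥ f) * (∫ φ : S → ℝ, fderiv ℝ H φ (A⁻¹ *ᵥ w) * (weight A φ * source f φ))
        + ((A⁻¹ *ᵥ w) ⬝ᵥ f) * (∫ φ : S → ℝ, fderiv ℝ H φ (A⁻¹ *ᵥ w') * (weight A φ * source f φ))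
        + ∫ φ : S → ℝ, fderiv ℝ (fun ψ : S → ℝ => fderiv ℝ H ψ (A⁻¹ *ᵥ w)) φ (A⁻¹ *ᵥ w')
            * (weight A φ * source f φ) := by
  have hH1 : ContDiff ℝ 1 H := hH.of_le (by norm_num)
  -- first field: Φ(w) against Φ(w′)·H
  have step1 := ibp_one_field A hA f hH1 h0 h1 w w'
  -- second field against the δ/δΦ-end `∂_{Cw}H ∈ C¹_b`
  have step2 := ibp_source A hA f (contDiff_one_fderiv_apply hH (A⁻¹ *ᵥ w))
    (norm_fderiv_apply_le h1 (A⁻¹ *ᵥ w)) (norm_fderiv_fderiv_apply_le hH h2 (A⁻¹ *ᵥ w)) w'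
  -- second field against `H` (the ℱ-end of the first contraction)
  have step3 := ibp_source A hA f hH1 h0 h1 w'
  rw [step1, step2, step3]
  ring

/-! ## §3  The vacuum pair: closed loop + ℱ–ℱ train -/

/-- **"a closed loop … or … a train of covariances beginning and ending in ℱ"** — the pair with nothing else to
contract to (`H = 1`): `∫Φ(w)Φ(w′)dμ = [⟨Cw,w′⟩ + ⟨Cw,ℱ⟩⟨Cw′,ℱ⟩]·Z`. [cite: BalabanImbrieJaffe1988, §5.13 p.305–306] -/
theorem pair_vacuum (A : Matrix S S ℝ) (hA : A.PosDef) (f w w' : S → ℝ) :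
    ∫ φ : S → ℝ, (φ ⬝ᵥ w) * (φ ⬝ᵥ w') * (weight A φ * source f φ)
      = (((A⁻¹ *ᵥ w) ⬝ᵥ w') + ((A⁻¹ *ᵥ w) ⬝ᵥ f) * ((A⁻¹ *ᵥ w') ⬝ᵥ f))
          * ∫ φ : S → ℝ, weight A φ * source f φ := by
  have hD1 : (fderiv ℝ fun _ : S → ℝ => (1:ℝ)) = fun _ => 0 := funext fun ψ => fderiv_const_apply (1:ℝ)
  have h := pair_contraction A hA f (H := fun _ => (1:ℝ)) contDiff_const (K₀ := 1) (K₁ := 0) (K₂ := 0)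
    (fun _ => norm_one.le) (fun φ => le_of_eq (by rw [fderiv_const_apply, norm_zero]))
    (fun φ => le_of_eq (by rw [hD1, fderiv_const_apply, ContinuousLinearMap.opNorm_zero])) w w'
  simp only [mul_one, one_mul, fderiv_const_apply, _root_.zero_apply, zero_mul, integral_zero,
    mul_zero, add_zero] at h
  exact h

/-! ## §4  Truncation: only trains beginning with a `δ/δΦ` survive -/

/-- **"If a closed loop forms, or if a train of covariances beginning and ending in ℱ forms, then the term disappears
with truncation. Thus we have only trains beginning with a δ/δΦ and ending in either δ/δΦ or ℱ."** — the truncated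
pair, cleared of denominators: `Z·∫Φ(w)Φ(w′)H dμ − (∫Φ(w)Φ(w′)dμ)(∫H dμ) =
Z·[⟨Cw′,ℱ⟩∫∂_{Cw}H dμ + ⟨Cw,ℱ⟩∫∂_{Cw′}H dμ + ∫∂_{Cw′}∂_{Cw}H dμ]` (`H ∈ C²_b`).
[cite: BalabanImbrieJaffe1988, §5.13 p.305–306] -/
theorem pair_truncated (A : Matrix S S ℝ) (hA : A.PosDef) (f : S → ℝ) {H : (S → ℝ) → ℝ} (hH : ContDiff ℝ 2 H)
    {K₀ K₁ K₂ : ℝ} (h0 : ∀ φ, ‖H φ‖ ≤ K₀) (h1 : ∀ φ, ‖fderiv ℝ H φ‖ ≤ K₁)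
    (h2 : ∀ φ, ‖fderiv ℝ (fderiv ℝ H) φ‖ ≤ K₂) (w w' : S → ℝ) :
    (∫ φ : S → ℝ, weight A φ * source f φ)
        * (∫ φ : S → ℝ, (φ ⬝ᵥ w) * (φ ⬝ᵥ w') * H φ * (weight A φ * source f φ))
      - (∫ φ : S → ℝ, (φ ⬝ᵥ w) * (φ ⬝ᵥ w') * (weight A φ * source f φ))
        * (∫ φ : S → ℝ, H φ * (weight A φ * source f φ))
      = (∫ φ : S → ℝ, weight A φ * source f φ)
        * (((A⁻¹ *ᵥ w') ⬝ᵥ f) * (∫ φ : S → ℝ, fderiv ℝ H φ (A⁻¹ *ᵥ w) * (weight A φ * source f φ))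
          + ((A⁻¹ *ᵥ w) ⬝ᵥ f) * (∫ φ : S → ℝ, fderiv ℝ H φ (A⁻¹ *ᵥ w') * (weight A φ * source f φ))
          + ∫ φ : S → ℝ, fderiv ℝ (fun ψ : S → ℝ => fderiv ℝ H ψ (A⁻¹ *ᵥ w)) φ (A⁻¹ *ᵥ w')
              * (weight A φ * source f φ)) := by
  rw [pair_contraction A hA f hH h0 h1 h2 w w', pair_vacuum A hA f w w']
  ring

/-- **THE TRUNCATED PAIR, normalized** (`⟨X⟩ := ∫X dμ / Z`, `Z = ∫dμ > 0`):
`⟨Φ(w)Φ(w′)H⟩ − ⟨Φ(w)Φ(w′)⟩⟨H⟩ = ⟨Cw′,ℱ⟩⟨∂_{Cw}H⟩ + ⟨Cw,ℱ⟩⟨∂_{Cw′}H⟩ + ⟨∂_{Cw′}∂_{Cw}H⟩` — the closed loop `⟨Cw,w′⟩`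
and the ℱ–ℱ train `⟨Cw,ℱ⟩⟨Cw′,ℱ⟩` have disappeared; *"only trains beginning with a δ/δΦ and ending in either δ/δΦ or
ℱ"* remain. [cite: BalabanImbrieJaffe1988, §5.13 p.305–306] -/
theorem pair_truncated_expectation (A : Matrix S S ℝ) (hA : A.PosDef) (f : S → ℝ) {H : (S → ℝ) → ℝ}
    (hH : ContDiff ℝ 2 H) {K₀ K₁ K₂ : ℝ} (h0 : ∀ φ, ‖H φ‖ ≤ K₀) (h1 : ∀ φ, ‖fderiv ℝ H φ‖ ≤ K₁)
    (h2 : ∀ φ, ‖fderiv ℝ (fderiv ℝ H) φ‖ ≤ K₂) (w w' : S → ℝ) :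
    (∫ φ : S → ℝ, (φ ⬝ᵥ w) * (φ ⬝ᵥ w') * H φ * (weight A φ * source f φ))
          / (∫ φ : S → ℝ, weight A φ * source f φ)
      - (∫ φ : S → ℝ, (φ ⬝ᵥ w) * (φ ⬝ᵥ w') * (weight A φ * source f φ))
          / (∫ φ : S → ℝ, weight A φ * source f φ)
        * ((∫ φ : S → ℝ, H φ * (weight A φ * source f φ)) / (∫ φ : S → ℝ, weight A φ * source f φ))
      = ((A⁻¹ *ᵥ w') ⬝ᵥ f)
          * ((∫ φ : S → ℝ, fderiv ℝ H φ (A⁻¹ *ᵥ w) * (weight A φ * source f φ))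
              / (∫ φ : S → ℝ, weight A φ * source f φ))
        + ((A⁻¹ *ᵥ w) ⬝ᵥ f)
          * ((∫ φ : S → ℝ, fderiv ℝ H φ (A⁻¹ *ᵥ w') * (weight A φ * source f φ))
              / (∫ φ : S → ℝ, weight A φ * source f φ))
        + (∫ φ : S → ℝ, fderiv ℝ (fun ψ : S → ℝ => fderiv ℝ H ψ (A⁻¹ *ᵥ w)) φ (A⁻¹ *ᵥ w')
              * (weight A φ * source f φ))
            / (∫ φ : S → ℝ, weight A φ * source f φ) := by
  have hZ : (∫ φ : S → ℝ, weight A φ * source f φ) ≠ 0 := (integral_weight_mul_source_pos hA f).ne'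
  rw [pair_contraction A hA f hH h0 h1 h2 w w', pair_vacuum A hA f w w']
  field_simp
  ring

end Literature.MathematicalPhysics.QuantumFieldTheory.BalabanImbrieJaffe1984to88.BIJ88TruncatedPair306
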